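import Mathlib
import Literature.Analysis.PDE.Wave1DFarEnergySourced
import HarnessLib

/-!
# Real-valued outgoing/incoming far energies: finiteness, monotonicity, limits, comparison

Analysis/PDE support file (everything proved). Let `ψ` be `C²` with `ψ_tt − ψ_xx + V(x)ψ = F`,
`V ≥ 0` and `F` continuous, `F = 0` on `{x ≥ c}` (a function solving the homogeneous equation to the
right of `c`; `F` may be taken to be the residual of `ψ` itself). If the initial energy on `(c, ∞)`
is finite then:
* `wave1D_farEnergy_integrable…`: the energy density is integrable on `(c + |t|, ∞)` for every `t`,
  and the lower Lebesgue exterior energy is the `ofReal` of the Bochner one;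
* `wave1D_farEnergy_real_antitone / …_monotone`: `t ↦ ∫_{x>c+|t|} e(t,·)` is non-increasing for
  `t ≥ 0` and non-decreasing for `t ≤ 0`, bounded by the initial energy;
* `wave1D_exists_farEnergy_limits`: both limits `L⁺ = lim_{t→+∞}`, `L⁻ = lim_{t→−∞}` exist in
  `[0, E(0)]`;
* `wave1D_farEnergy_two_solutions`: for two such functions, `E[ψ₁](t) ≤ 2E[ψ₂](t) + 2E[ψ₁−ψ₂](0)`
  (pointwise splitting plus monotonicity for the difference).
These are the bookkeeping tools of the density and comparison steps of the far-side channel estimate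
of route PhotonSphereChannels (`FixedModeChannels`, stmt-FinalStateConjecture-10048). Folklore.
-/

noncomputable section

namespace Literature.Analysis.PDE

open MeasureTheory Set Filter Topology

variable {V : ℝ → ℝ} {F ψ : ℝ → ℝ → ℝ}

/-- From a finite lower Lebesgue integral of a continuous non-negative function on `Ioi a` to
Bochner integrability, with the conversion identity. [folklore] -/
theorem integrableOn_Ioi_of_lintegral_lt_top {f : ℝ → ℝ} (hf : Continuous f) (hf0 : ∀ x, 0 ≤ f x)
    {a : ℝ} (hfin : ∫⁻ x in Ioi a, ENNReal.ofReal (f x) < ⊤) :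
    IntegrableOn f (Ioi a) ∧
      ENNReal.ofReal (∫ x in Ioi a, f x) = ∫⁻ x in Ioi a, ENNReal.ofReal (f x) := by
  have hint : IntegrableOn f (Ioi a) :=
    ⟨hf.aestronglyMeasurable, (hasFiniteIntegral_iff_ofReal (ae_of_all _ hf0)).2 hfin⟩
  exact ⟨hint, ofReal_integral_eq_lintegral_ofReal hint (ae_of_all _ hf0)⟩

section
variable (hV : Continuous V) (hV0 : ∀ x, 0 ≤ V x) (hF : Continuous (Function.uncurry F))
  (hψ : ContDiff ℝ 2 (Function.uncurry ψ))
  (hsol : ∀ t x, iteratedDeriv 2 (fun τ => ψ τ x) t - iteratedDeriv 2 (ψ t) x + V x * ψ t x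
    = F t x)
  {c : ℝ} (hF0 : ∀ τ x, c ≤ x → F τ x = 0)
  (hfin : ∫⁻ x in Ioi c, ENNReal.ofReal
    (deriv (fun τ => ψ τ x) 0 ^ 2 + deriv (ψ 0) x ^ 2 + V x * ψ 0 x ^ 2) < ⊤)
include hV hV0 hF hψ hsol hF0 hfin

omit hfin in
/-- **Lower Lebesgue exterior energy is bounded by the initial one**, both time directions.
[folklore] -/
theorem wave1D_farEnergy_lintegral_le_initial (t : ℝ) :
    ∫⁻ x in Ioi (c + |t|), ENNReal.ofReal
        (deriv (fun τ => ψ τ x) t ^ 2 + deriv (ψ t) x ^ 2 + V x * ψ t x ^ 2)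
      ≤ ∫⁻ x in Ioi c, ENNReal.ofReal
        (deriv (fun τ => ψ τ x) 0 ^ 2 + deriv (ψ 0) x ^ 2 + V x * ψ 0 x ^ 2) := by
  rcases le_total 0 t with ht | ht
  · rw [abs_of_nonneg ht]
    have h := wave1D_lintegral_Ioi_energy_mono_of_source hV hV0 hF hψ hsol (c := c) (s := 0)
      (t := t) ht (fun τ x hx => hF0 τ x (by simpa using hx))
    simpa using h
  · rw [abs_of_nonpos ht, ← sub_eq_add_neg]
    have h := wave1D_lintegral_Ioi_energy_mono_of_source_backward hV hV0 hF hψ hsol (c := c)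
      (s := 0) (t := t) ht (fun τ x hx => hF0 τ x (by simpa using hx))
    simpa using h

/-- **Finite exterior energy at all times; Bochner form.** [folklore] -/
theorem wave1D_farEnergy_integrableOn (t : ℝ) :
    IntegrableOn (fun x => deriv (fun τ => ψ τ x) t ^ 2 + deriv (ψ t) x ^ 2 + V x * ψ t x ^ 2)
        (Ioi (c + |t|)) ∧
      ENNReal.ofReal (∫ x in Ioi (c + |t|),
          (deriv (fun τ => ψ τ x) t ^ 2 + deriv (ψ t) x ^ 2 + V x * ψ t x ^ 2))
        = ∫⁻ x in Ioi (c + |t|), ENNReal.ofReal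
          (deriv (fun τ => ψ τ x) t ^ 2 + deriv (ψ t) x ^ 2 + V x * ψ t x ^ 2) :=
  integrableOn_Ioi_of_lintegral_lt_top
    ((continuous_wave1D_energyDensity hV hψ).comp (continuous_const.prodMk continuous_id))
    (fun x => wave1D_energyDensity_nonneg hV0 t x)
    ((wave1D_farEnergy_lintegral_le_initial hV hV0 hF hψ hsol hF0 t).trans_lt hfin)

/-- **Real exterior energy: forward monotonicity** (`0 ≤ s ≤ t`). [folklore] -/
theorem wave1D_farEnergy_real_mono_nonneg {s t : ℝ} (hs : 0 ≤ s) (hst : s ≤ t) :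
    (∫ x in Ioi (c + |t|), (deriv (fun τ => ψ τ x) t ^ 2 + deriv (ψ t) x ^ 2 + V x * ψ t x ^ 2))
      ≤ ∫ x in Ioi (c + |s|),
          (deriv (fun τ => ψ τ x) s ^ 2 + deriv (ψ s) x ^ 2 + V x * ψ s x ^ 2) := by
  have h := wave1D_lintegral_Ioi_energy_mono_of_source hV hV0 hF hψ hsol (c := c) hst
    (fun τ x hx => hF0 τ x (by linarith))
  have it := (wave1D_farEnergy_integrableOn hV hV0 hF hψ hsol hF0 hfin t).2
  have is := (wave1D_farEnergy_integrableOn hV hV0 hF hψ hsol hF0 hfin s).2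
  rw [abs_of_nonneg (hs.trans hst)] at it ⊢
  rw [abs_of_nonneg hs] at is ⊢
  rw [← it, ← is] at h
  exact (ENNReal.ofReal_le_ofReal_iff (setIntegral_nonneg measurableSet_Ioi fun x _ =>
    wave1D_energyDensity_nonneg hV0 s x)).1 h

/-- **Real exterior energy: backward monotonicity** (`t ≤ s ≤ 0`). [folklore] -/
theorem wave1D_farEnergy_real_mono_nonpos {s t : ℝ} (hs : s ≤ 0) (hts : t ≤ s) :
    (∫ x in Ioi (c + |t|), (deriv (fun τ => ψ τ x) t ^ 2 + deriv (ψ t) x ^ 2 + V x * ψ t x ^ 2))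
      ≤ ∫ x in Ioi (c + |s|),
          (deriv (fun τ => ψ τ x) s ^ 2 + deriv (ψ s) x ^ 2 + V x * ψ s x ^ 2) := by
  have h := wave1D_lintegral_Ioi_energy_mono_of_source_backward hV hV0 hF hψ hsol (c := c) hts
    (fun τ x hx => hF0 τ x (by linarith))
  have it := (wave1D_farEnergy_integrableOn hV hV0 hF hψ hsol hF0 hfin t).2
  have is := (wave1D_farEnergy_integrableOn hV hV0 hF hψ hsol hF0 hfin s).2
  have et : c + |t| = c - t := by rw [abs_of_nonpos (hts.trans hs)]; ring
  have es : c + |s| = c - s := by rw [abs_of_nonpos hs]; ring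
  rw [et] at it ⊢
  rw [es] at is ⊢
  rw [← it, ← is] at h
  exact (ENNReal.ofReal_le_ofReal_iff (setIntegral_nonneg measurableSet_Ioi fun x _ =>
    wave1D_energyDensity_nonneg hV0 s x)).1 h

/-- **Both channel limits exist**, with `0 ≤ L± ≤ E(0)`. [folklore] -/
theorem wave1D_exists_farEnergy_limits :
    ∃ Lp Lm : ℝ, 0 ≤ Lp ∧ 0 ≤ Lm ∧
      Lp ≤ (∫ x in Ioi c, (deriv (fun τ => ψ τ x) 0 ^ 2 + deriv (ψ 0) x ^ 2 + V x * ψ 0 x ^ 2)) ∧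
      Lm ≤ (∫ x in Ioi c, (deriv (fun τ => ψ τ x) 0 ^ 2 + deriv (ψ 0) x ^ 2 + V x * ψ 0 x ^ 2)) ∧
      Tendsto (fun t => ∫ x in Ioi (c + |t|),
        (deriv (fun τ => ψ τ x) t ^ 2 + deriv (ψ t) x ^ 2 + V x * ψ t x ^ 2)) atTop (𝓝 Lp) ∧
      Tendsto (fun t => ∫ x in Ioi (c + |t|),
        (deriv (fun τ => ψ τ x) t ^ 2 + deriv (ψ t) x ^ 2 + V x * ψ t x ^ 2)) atBot (𝓝 Lm) := by
  set E : ℝ → ℝ := fun t => ∫ x in Ioi (c + |t|),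
    (deriv (fun τ => ψ τ x) t ^ 2 + deriv (ψ t) x ^ 2 + V x * ψ t x ^ 2) with hE
  have hE0 : ∀ t, 0 ≤ E t := fun t =>
    setIntegral_nonneg measurableSet_Ioi fun x _ => wave1D_energyDensity_nonneg hV0 t x
  have hEle : ∀ t, E t ≤ E 0 := by
    intro t
    rcases le_total 0 t with ht | ht
    · exact wave1D_farEnergy_real_mono_nonneg hV hV0 hF hψ hsol hF0 hfin le_rfl ht
    · exact wave1D_farEnergy_real_mono_nonpos hV hV0 hF hψ hsol hF0 hfin le_rfl ht
  have hE00 : E 0 = ∫ x in Ioi c,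
      (deriv (fun τ => ψ τ x) 0 ^ 2 + deriv (ψ 0) x ^ 2 + V x * ψ 0 x ^ 2) := by
    simp [hE]
  -- forward: antitone extension `t ↦ E (max t 0)`
  set Ep : ℝ → ℝ := fun t => E (max t 0) with hEp
  have hanti : Antitone Ep := fun s t hst =>
    wave1D_farEnergy_real_mono_nonneg hV hV0 hF hψ hsol hF0 hfin (le_max_right _ _)
      (max_le_max hst le_rfl)
  have hbdd : BddBelow (range Ep) := ⟨0, by rintro _ ⟨t, rfl⟩; exact hE0 _⟩
  have hlimp := tendsto_atTop_ciInf hanti hbdd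
  -- backward: monotone extension `t ↦ E (min t 0)`
  set Em : ℝ → ℝ := fun t => E (min t 0) with hEm
  have hmono : Monotone Em := fun s t hst =>
    wave1D_farEnergy_real_mono_nonpos hV hV0 hF hψ hsol hF0 hfin (min_le_right _ _)
      (min_le_min hst le_rfl)
  have hbdd' : BddBelow (range Em) := ⟨0, by rintro _ ⟨t, rfl⟩; exact hE0 _⟩
  have hlimm := tendsto_atBot_ciInf hmono hbdd'
  refine ⟨⨅ t, Ep t, ⨅ t, Em t, le_ciInf fun t => hE0 _, le_ciInf fun t => hE0 _, ?_, ?_, ?_, ?_⟩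
  · rw [← hE00]; exact (ciInf_le hbdd 0).trans (by simp [hEp])
  · rw [← hE00]; exact (ciInf_le hbdd' 0).trans (by simp [hEm])
  · refine hlimp.congr' ?_
    filter_upwards [Filter.eventually_ge_atTop 0] with t ht
    simp [hEp, max_eq_left ht]
  · refine hlimm.congr' ?_
    filter_upwards [Filter.eventually_le_atBot 0] with t ht
    simp [hEm, min_eq_left ht]

end

/-- **Comparing two functions**: for `C²` functions `ψ₁, ψ₂` whose residuals vanish on `{x ≥ c}`
and whose difference has finite initial energy on `(c,∞)`, the exterior energy splits as
`E[ψ₁](t) ≤ 2 E[ψ₂](t) + 2 E[ψ₁ − ψ₂](0)` (lower Lebesgue integrals). [folklore] -/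
theorem wave1D_farEnergy_lintegral_two (hV : Continuous V) (hV0 : ∀ x, 0 ≤ V x)
    {ψ₁ ψ₂ F₁ F₂ : ℝ → ℝ → ℝ} (hF₁ : Continuous (Function.uncurry F₁))
    (hF₂ : Continuous (Function.uncurry F₂)) (hψ₁ : ContDiff ℝ 2 (Function.uncurry ψ₁))
    (hψ₂ : ContDiff ℝ 2 (Function.uncurry ψ₂))
    (hsol₁ : ∀ t x, iteratedDeriv 2 (fun τ => ψ₁ τ x) t - iteratedDeriv 2 (ψ₁ t) x + V x * ψ₁ t x
      = F₁ t x)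
    (hsol₂ : ∀ t x, iteratedDeriv 2 (fun τ => ψ₂ τ x) t - iteratedDeriv 2 (ψ₂ t) x + V x * ψ₂ t x
      = F₂ t x)
    {c : ℝ} (hF₁0 : ∀ τ x, c ≤ x → F₁ τ x = 0) (hF₂0 : ∀ τ x, c ≤ x → F₂ τ x = 0) (t : ℝ) :
    ∫⁻ x in Ioi (c + |t|), ENNReal.ofReal
        (deriv (fun τ => ψ₁ τ x) t ^ 2 + deriv (ψ₁ t) x ^ 2 + V x * ψ₁ t x ^ 2)
      ≤ (2 * ∫⁻ x in Ioi (c + |t|), ENNReal.ofReal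
          (deriv (fun τ => ψ₂ τ x) t ^ 2 + deriv (ψ₂ t) x ^ 2 + V x * ψ₂ t x ^ 2))
        + 2 * ∫⁻ x in Ioi c, ENNReal.ofReal
          (deriv (fun τ => ψ₁ τ x - ψ₂ τ x) 0 ^ 2 + deriv (fun y => ψ₁ 0 y - ψ₂ 0 y) x ^ 2
            + V x * (ψ₁ 0 x - ψ₂ 0 x) ^ 2) := by
  -- the difference `w = ψ₁ − ψ₂`
  set w : ℝ → ℝ → ℝ := fun t x => ψ₁ t x - ψ₂ t x with hw
  have hwC : ContDiff ℝ 2 (Function.uncurry w) := hψ₁.sub hψ₂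
  have hFw : Continuous (Function.uncurry fun t x => F₁ t x - F₂ t x) := hF₁.sub hF₂
  have hslice : ∀ (φ : ℝ → ℝ → ℝ), ContDiff ℝ 2 (Function.uncurry φ) → ∀ t x,
      ContDiff ℝ 2 (fun τ => φ τ x) ∧ ContDiff ℝ 2 (φ t) := fun φ hφ t x =>
    ⟨hφ.comp (contDiff_id.prodMk contDiff_const), hφ.comp (contDiff_const.prodMk contDiff_id)⟩
  have hwsol : ∀ t x, iteratedDeriv 2 (fun τ => w τ x) t - iteratedDeriv 2 (w t) x + V x * w t x
      = F₁ t x - F₂ t x := by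
    intro t x
    have e1 : iteratedDeriv 2 (fun τ => w τ x) t
        = iteratedDeriv 2 (fun τ => ψ₁ τ x) t - iteratedDeriv 2 (fun τ => ψ₂ τ x) t :=
      iteratedDeriv_fun_sub ((hslice ψ₁ hψ₁ t x).1.contDiffAt) ((hslice ψ₂ hψ₂ t x).1.contDiffAt)
    have e2 : iteratedDeriv 2 (w t) x = iteratedDeriv 2 (ψ₁ t) x - iteratedDeriv 2 (ψ₂ t) x := by
      show iteratedDeriv 2 (fun y => ψ₁ t y - ψ₂ t y) x = _
      exact iteratedDeriv_fun_sub ((hslice ψ₁ hψ₁ t x).2.contDiffAt)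
        ((hslice ψ₂ hψ₂ t x).2.contDiffAt)
    rw [e1, e2]
    have h1 := hsol₁ t x; have h2 := hsol₂ t x
    simp only [hw]; linarith
  -- energy of `w` at time `t` on the exterior region is at most its initial energy on `(c, ∞)`
  have hwt : ∫⁻ x in Ioi (c + |t|), ENNReal.ofReal
      (deriv (fun τ => w τ x) t ^ 2 + deriv (w t) x ^ 2 + V x * w t x ^ 2)
      ≤ ∫⁻ x in Ioi c, ENNReal.ofReal
        (deriv (fun τ => w τ x) 0 ^ 2 + deriv (w 0) x ^ 2 + V x * w 0 x ^ 2) := by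
    rcases le_total 0 t with ht | ht
    · rw [abs_of_nonneg ht]
      have h := wave1D_lintegral_Ioi_energy_mono_of_source hV hV0 hFw hwC hwsol (c := c)
        (s := 0) (t := t) ht (fun τ x hx => by
          have h1 := hF₁0 τ x (by simpa using hx); have h2 := hF₂0 τ x (by simpa using hx)
          show F₁ τ x - F₂ τ x = 0; linarith)
      simpa using h
    · rw [abs_of_nonpos ht, ← sub_eq_add_neg]
      have h := wave1D_lintegral_Ioi_energy_mono_of_source_backward hV hV0 hFw hwC hwsol (c := c)
        (s := 0) (t := t) ht (fun τ x hx => by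
          have h1 := hF₁0 τ x (by simpa using hx); have h2 := hF₂0 τ x (by simpa using hx)
          show F₁ τ x - F₂ τ x = 0; linarith)
      simpa using h
  -- pointwise splitting `e[ψ₁] ≤ 2 e[ψ₂] + 2 e[w]`
  have hd1 : ∀ t x, DifferentiableAt ℝ (fun τ => ψ₂ τ x) t ∧ DifferentiableAt ℝ (ψ₂ t) x :=
    fun t x => ⟨(hslice ψ₂ hψ₂ t x).1.differentiable (by norm_num) t,
      (hslice ψ₂ hψ₂ t x).2.differentiable (by norm_num) x⟩
  have hdw : ∀ t x, DifferentiableAt ℝ (fun τ => w τ x) t ∧ DifferentiableAt ℝ (w t) x :=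
    fun t x => ⟨(hslice w hwC t x).1.differentiable (by norm_num) t,
      (hslice w hwC t x).2.differentiable (by norm_num) x⟩
  have hpt : ∀ x, ENNReal.ofReal
      (deriv (fun τ => ψ₁ τ x) t ^ 2 + deriv (ψ₁ t) x ^ 2 + V x * ψ₁ t x ^ 2)
      ≤ 2 * ENNReal.ofReal (deriv (fun τ => ψ₂ τ x) t ^ 2 + deriv (ψ₂ t) x ^ 2 + V x * ψ₂ t x ^ 2)
        + 2 * ENNReal.ofReal (deriv (fun τ => w τ x) t ^ 2 + deriv (w t) x ^ 2
          + V x * w t x ^ 2) := by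
    intro x
    have e1 : (fun τ => ψ₁ τ x) = fun τ => ψ₂ τ x + w τ x := by funext τ; simp [hw]
    have e2 : ψ₁ t = fun y => ψ₂ t y + w t y := by funext y; simp [hw]
    have hD1 : deriv (fun τ => ψ₁ τ x) t
        = deriv (fun τ => ψ₂ τ x) t + deriv (fun τ => w τ x) t := by
      rw [e1]; exact deriv_fun_add (hd1 t x).1 (hdw t x).1
    have hD2 : deriv (ψ₁ t) x = deriv (ψ₂ t) x + deriv (w t) x := by
      rw [e2]; exact deriv_fun_add (hd1 t x).2 (hdw t x).2
    have e3 : ψ₁ t x = ψ₂ t x + w t x := by simp [hw]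
    rw [hD1, hD2, e3]
    have hVx := hV0 x
    rw [← ENNReal.ofReal_ofNat 2, ← ENNReal.ofReal_mul (by norm_num), ← ENNReal.ofReal_mul
      (by norm_num), ← ENNReal.ofReal_add
      (by have := wave1D_energyDensity_nonneg hV0 (ψ := ψ₂) t x; positivity)
      (by have := wave1D_energyDensity_nonneg hV0 (ψ := w) t x; positivity)]
    refine ENNReal.ofReal_le_ofReal ?_
    nlinarith [sq_nonneg (deriv (fun τ => ψ₂ τ x) t - deriv (fun τ => w τ x) t),
      sq_nonneg (deriv (ψ₂ t) x - deriv (w t) x),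
      mul_nonneg hVx (sq_nonneg (ψ₂ t x - w t x))]
  calc ∫⁻ x in Ioi (c + |t|), ENNReal.ofReal
          (deriv (fun τ => ψ₁ τ x) t ^ 2 + deriv (ψ₁ t) x ^ 2 + V x * ψ₁ t x ^ 2)
      ≤ ∫⁻ x in Ioi (c + |t|), (2 * ENNReal.ofReal
          (deriv (fun τ => ψ₂ τ x) t ^ 2 + deriv (ψ₂ t) x ^ 2 + V x * ψ₂ t x ^ 2)
        + 2 * ENNReal.ofReal (deriv (fun τ => w τ x) t ^ 2 + deriv (w t) x ^ 2
          + V x * w t x ^ 2)) := lintegral_mono fun x => hpt x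
    _ = (2 * ∫⁻ x in Ioi (c + |t|), ENNReal.ofReal
          (deriv (fun τ => ψ₂ τ x) t ^ 2 + deriv (ψ₂ t) x ^ 2 + V x * ψ₂ t x ^ 2))
        + 2 * ∫⁻ x in Ioi (c + |t|), ENNReal.ofReal (deriv (fun τ => w τ x) t ^ 2
          + deriv (w t) x ^ 2 + V x * w t x ^ 2) := by
        have m1 : Measurable fun x => ENNReal.ofReal
            (deriv (fun τ => ψ₂ τ x) t ^ 2 + deriv (ψ₂ t) x ^ 2 + V x * ψ₂ t x ^ 2) :=
          ((continuous_wave1D_energyDensity hV hψ₂).comp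
            (continuous_const.prodMk continuous_id)).measurable.ennreal_ofReal
        have m2 : Measurable fun x => ENNReal.ofReal
            (deriv (fun τ => w τ x) t ^ 2 + deriv (w t) x ^ 2 + V x * w t x ^ 2) :=
          ((continuous_wave1D_energyDensity hV hwC).comp
            (continuous_const.prodMk continuous_id)).measurable.ennreal_ofReal
        rw [lintegral_add_left (m1.const_mul _), lintegral_const_mul _ m1, lintegral_const_mul _ m2]
    _ ≤ _ := by gcongr

end Literature.Analysis.PDE
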